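import Mathlib
import Literature.MathematicalPhysics.QuantumLattice.WilsonDiracAP
import Summits.QuantumFields.QCD.Theorems.QuarksAsStableActionCriticalLineDiamagnetismStubDeltaBounds

/-!
# The one-loop margin from the tadpole, the cell inequalities and the Hessian margin
(auxiliary lemmas; helper for crux stmt-QuantumFields-9734, line `Sketch`, stub `stub_oneLoopMargin_of`)

What.  Small general facts used by the assembly `stub_oneLoopMargin_of` (sibling file
`…StubOneLoopMarginOf`):
* the perturbation of the `r = 1` Wilson–Dirac operator under `u ↦ u · X` (constant
  direction-dependent unitaries `u`, any `U(3)` link field `X`) IS the hopping form `Δ(E)` of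
  `E = X − 1` (`wilsonDirac_dir_sub_eq`; entrywise this is `StubDeltaBounds.wilsonDirac_dir_sub_apply`
  with `ρ(uX) − ρ(u) = u(X − 1)` and `ρ(uX)⁻¹ − ρ(u)⁻¹ = (u(X − 1))ᴴ`);
* `3 × 3` matrix algebra of the anti-Hermitian part `Y = (E − Eᴴ)/2` and of `X⁻¹ − 1 = (X − 1)ᴴ`;
* the colour traces `S_μ = Σ_x tr (W(x,μ) − 1)` of a link field on the `2⁴` block with
  `W(x + μ̂, μ) = W(x, μ)⁻¹` are real, with real part minus the link deficit;
* the Frobenius norm of the test field `tst_μ` (`= 1/3`);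
* elementary real inequalities (`c⁻¹, c^{-1/2} ≤ c^{-3/2} + 1`, a square-root bound) and the final
  real bookkeeping of the assembly (`bookkeeping`).

References: Montvay–Münster, *Quantum Fields on a Lattice* §4.2 (Wilson fermions); folklore linear
algebra and real arithmetic.  Pure theorem file (no `def`s).
-/

noncomputable section

open scoped BigOperators Classical Matrix ComplexConjugate
open Finset
open Literature.MathematicalPhysics.QuantumLattice Literature.MathematicalPhysics.QuantumFieldTheory
  Literature.Probability.LatticeModels

namespace Summit.QuantumFields.QCD.Cruxes.CriticalLineDiamagnetism.ChessboardCellGain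

namespace OneLoopMarginOf

/-! ### The perturbation `D[u·X] − D[u]` is the hopping form of `E = X − 1` -/

/-- `ρ(u g) − ρ(u) = u (g − 1)`. -/
theorem rep_mul_sub (u g : Matrix.unitaryGroup (Fin 3) ℂ) :
    unitaryFundamentalRep (Fin 3) ℂ (u * g) - unitaryFundamentalRep (Fin 3) ℂ u =
      (u : Matrix (Fin 3) (Fin 3) ℂ) * ((g : Matrix (Fin 3) (Fin 3) ℂ) - 1) := by
  -- adapted from `StubDeltaBounds.sum_norm_sq_rep_mul_sub`
  simp only [unitaryFundamentalRep_apply, Matrix.UnitaryGroup.mul_val]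
  rw [Matrix.mul_sub, Matrix.mul_one]

/-- `ρ((u g)⁻¹) − ρ(u⁻¹) = (u (g − 1))ᴴ`. -/
theorem rep_mul_inv_sub (u g : Matrix.unitaryGroup (Fin 3) ℂ) :
    unitaryFundamentalRep (Fin 3) ℂ (u * g)⁻¹ - unitaryFundamentalRep (Fin 3) ℂ u⁻¹ =
      ((u : Matrix (Fin 3) (Fin 3) ℂ) * ((g : Matrix (Fin 3) (Fin 3) ℂ) - 1))ᴴ := by
  -- adapted from `StubDeltaBounds.sum_norm_sq_rep_mul_inv_sub`
  simp only [unitaryFundamentalRep_apply, Matrix.UnitaryGroup.inv_val,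
    Matrix.UnitaryGroup.mul_val]
  rw [Matrix.mul_sub, Matrix.mul_one, ← Matrix.star_eq_conjTranspose, star_sub]

variable {L : ℕ} in
/-- **`D[u·X] − D[u] = Δ(E)`, `E = X − 1`**: the perturbation of the `r = 1` Wilson–Dirac operator
with constant direction-dependent unitaries `u` by a link field `X` is the hopping form of `X − 1`. -/
theorem wilsonDirac_dir_sub_eq (u : Fin 4 → Matrix.unitaryGroup (Fin 3) ℂ)
    (X : GaugeConfig 4 L (Matrix.unitaryGroup (Fin 3) ℂ)) (m : ℝ)
    (E : Edge 4 L → Matrix (Fin 3) (Fin 3) ℂ)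
    (hE : ∀ e, E e = ((X e : Matrix.unitaryGroup (Fin 3) ℂ) : Matrix (Fin 3) (Fin 3) ℂ) - 1) :
    wilsonDirac (unitaryFundamentalRep (Fin 3) ℂ) (fun e : Edge 4 L => u e.2 * X e) m 1 -
        wilsonDirac (unitaryFundamentalRep (Fin 3) ℂ) (fun e : Edge 4 L => u e.2) m 1 =
      Matrix.of fun p q : TorusSite 4 L × Fin 3 × Fin 4 => -(1 / 2 : ℂ) * ∑ μ : Fin 4,
        ((if q.1 = Site.shift p.1 μ then
            ((1 : Matrix (Fin 4) (Fin 4) ℂ) - euclideanGamma μ) p.2.2 q.2.2 *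
              (((u μ : Matrix.unitaryGroup (Fin 3) ℂ) : Matrix (Fin 3) (Fin 3) ℂ) * E (p.1, μ))
                p.2.1 q.2.1 else 0) +
          (if p.1 = Site.shift q.1 μ then
            ((1 : Matrix (Fin 4) (Fin 4) ℂ) + euclideanGamma μ) p.2.2 q.2.2 *
              (((u μ : Matrix.unitaryGroup (Fin 3) ℂ) : Matrix (Fin 3) (Fin 3) ℂ) * E (q.1, μ))ᴴ
                p.2.1 q.2.1 else 0)) := by
  ext p q
  rw [StubDeltaBounds.wilsonDirac_dir_sub_apply, Matrix.of_apply]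
  simp only [rep_mul_sub, rep_mul_inv_sub, hE]

/-! ### `3 × 3` matrix algebra -/

/-- The anti-Hermitian part `(A − Aᴴ)/2` is anti-Hermitian. -/
theorem conjTranspose_half_sub (A : Matrix (Fin 3) (Fin 3) ℂ) :
    ((1 / 2 : ℂ) • (A - Aᴴ))ᴴ = -((1 / 2 : ℂ) • (A - Aᴴ)) := by
  rw [Matrix.conjTranspose_smul, Matrix.conjTranspose_sub, Matrix.conjTranspose_conjTranspose,
    ← smul_neg, neg_sub]
  congr 1
  simp

/-- The anti-Hermitian part of `Aᴴ` is minus that of `A`. -/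
theorem half_sub_conjTranspose_of (A : Matrix (Fin 3) (Fin 3) ℂ) :
    (1 / 2 : ℂ) • (Aᴴ - Aᴴᴴ) = -((1 / 2 : ℂ) • (A - Aᴴ)) := by
  rw [Matrix.conjTranspose_conjTranspose, ← smul_neg, neg_sub]

/-- `W⁻¹ − 1 = (W − 1)ᴴ` on `U(3)`. -/
theorem coe_inv_sub_one (W : Matrix.unitaryGroup (Fin 3) ℂ) :
    (((W⁻¹ : Matrix.unitaryGroup (Fin 3) ℂ)) : Matrix (Fin 3) (Fin 3) ℂ) - 1 =
      (((W : Matrix (Fin 3) (Fin 3) ℂ)) - 1)ᴴ := by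
  rw [Matrix.UnitaryGroup.inv_val, Matrix.conjTranspose_sub, Matrix.conjTranspose_one,
    Matrix.star_eq_conjTranspose]

/-- `Re tr (A + B)² = Re tr A² + Re tr AB + Re tr BA + Re tr B²`. -/
theorem re_trace_add_mul_add {ι : Type*} [Fintype ι] (A B : Matrix ι ι ℂ) :
    ((A + B) * (A + B)).trace.re =
      (A * A).trace.re + ((A * B).trace.re + (B * A).trace.re + (B * B).trace.re) := by
  rw [Matrix.add_mul, Matrix.mul_add, Matrix.mul_add, Matrix.trace_add, Matrix.trace_add,
    Matrix.trace_add, Complex.add_re, Complex.add_re, Complex.add_re]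
  ring

/-! ### Colour traces on the `2⁴` block -/

/-- If `W(x + μ̂, μ) = W(x, μ)⁻¹` then `S_μ = Σ_x tr (W(x,μ) − 1)` is real. -/
theorem sum_trace_sub_one_im (W : Edge 4 2 → Matrix.unitaryGroup (Fin 3) ℂ) (μ : Fin 4)
    (hW : ∀ x : TorusSite 4 2, W (Site.shift x μ, μ) = (W (x, μ))⁻¹) :
    (∑ x : TorusSite 4 2,
      ((((W (x, μ) : Matrix.unitaryGroup (Fin 3) ℂ)) : Matrix (Fin 3) (Fin 3) ℂ) - 1).trace).im = 0 := by
  have h1 : ∑ x : TorusSite 4 2,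
      ((((W (x, μ) : Matrix.unitaryGroup (Fin 3) ℂ)) : Matrix (Fin 3) (Fin 3) ℂ) - 1).trace =
      ∑ x : TorusSite 4 2, ((((W (Site.shift x μ, μ) : Matrix.unitaryGroup (Fin 3) ℂ)) :
        Matrix (Fin 3) (Fin 3) ℂ) - 1).trace :=
    (Equiv.sum_comp (Equiv.addRight (Pi.single μ (1 : ZMod 2))) (fun x : TorusSite 4 2 =>
      ((((W (x, μ) : Matrix.unitaryGroup (Fin 3) ℂ)) : Matrix (Fin 3) (Fin 3) ℂ) - 1).trace)).symm
  have h2 : ∀ x : TorusSite 4 2, ((((W (Site.shift x μ, μ) : Matrix.unitaryGroup (Fin 3) ℂ)) :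
      Matrix (Fin 3) (Fin 3) ℂ) - 1).trace =
      conj (((((W (x, μ) : Matrix.unitaryGroup (Fin 3) ℂ)) : Matrix (Fin 3) (Fin 3) ℂ) - 1).trace) := by
    intro x
    rw [hW x, coe_inv_sub_one, Matrix.trace_conjTranspose, Complex.star_def]
  rw [← Complex.conj_eq_iff_im, map_sum]
  conv_rhs => rw [h1]
  exact (Finset.sum_congr rfl fun x _ => (h2 x).symm)

/-- `Re S_μ = −Σ_x (3 − Re tr W(x,μ))`. -/
theorem sum_trace_sub_one_re (W : Edge 4 2 → Matrix.unitaryGroup (Fin 3) ℂ) (μ : Fin 4) :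
    (∑ x : TorusSite 4 2,
      ((((W (x, μ) : Matrix.unitaryGroup (Fin 3) ℂ)) : Matrix (Fin 3) (Fin 3) ℂ) - 1).trace).re =
      -∑ x : TorusSite 4 2,
        (3 - ((((W (x, μ) : Matrix.unitaryGroup (Fin 3) ℂ)) : Matrix (Fin 3) (Fin 3) ℂ)).trace.re) := by
  rw [Complex.re_sum, ← Finset.sum_neg_distrib]
  refine Finset.sum_congr rfl fun x _ => ?_
  rw [Matrix.trace_sub, Matrix.trace_one, Complex.sub_re, Fintype.card_fin]
  norm_num

/-- Sums over the links of the block, direction by direction. -/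
theorem sum_edge_eq_sum_dir (f : Edge 4 2 → ℝ) :
    ∑ e : Edge 4 2, f e = ∑ μ : Fin 4, ∑ x : TorusSite 4 2, f (x, μ) := by
  rw [Fintype.sum_prod_type, Finset.sum_comm]

/-- The Frobenius norm of the test field `tst_μ = (1/3)·1` on the link `(0, μ)` is `1/3`. -/
theorem tst_norm_sq (μ : Fin 4) :
    ∑ e : Edge 4 2, ∑ a : Fin 3, ∑ b : Fin 3,
      ‖(if e = ((0 : TorusSite 4 2), μ) then (1 / 3 : ℂ) • (1 : Matrix (Fin 3) (Fin 3) ℂ) else 0)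
        a b‖ ^ 2 = 1 / 3 := by
  rw [Finset.sum_eq_single ((0 : TorusSite 4 2), μ) (fun e _ he => by simp [if_neg he]) (by simp)]
  simp [Matrix.one_apply, Fin.sum_univ_three]
  norm_num

/-! ### Real arithmetic -/

/-- `c⁻¹ ≤ c^{-3/2} + 1` for `c > 0` (with `c^{-3/2} = √c / c²`). -/
theorem inv_le (c : ℝ) (hc : 0 < c) : 1 / c ≤ Real.sqrt c / c ^ 2 + 1 := by
  obtain ⟨s, hs, rfl⟩ : ∃ s, 0 < s ∧ c = s ^ 2 :=
    ⟨Real.sqrt c, Real.sqrt_pos.2 hc, (Real.sq_sqrt hc.le).symm⟩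
  rw [Real.sqrt_sq hs.le, div_add_one (by positivity), div_le_div_iff₀ (by positivity) (by positivity),
    one_mul]
  rcases le_total s 1 with h | h
  · nlinarith [mul_nonneg (pow_nonneg hs.le 3) (sub_nonneg.2 h), pow_nonneg hs.le 6]
  · nlinarith [mul_nonneg (mul_nonneg (pow_nonneg hs.le 4) (sub_nonneg.2 h))
      (add_nonneg hs.le zero_le_one), pow_nonneg hs.le 3]

/-- `c^{-1/2} ≤ c^{-3/2} + 1` for `c > 0` (with `c^{-3/2} = √c / c²`). -/
theorem inv_sqrt_le (c : ℝ) (hc : 0 < c) : 1 / Real.sqrt c ≤ Real.sqrt c / c ^ 2 + 1 := by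
  obtain ⟨s, hs, rfl⟩ : ∃ s, 0 < s ∧ c = s ^ 2 :=
    ⟨Real.sqrt c, Real.sqrt_pos.2 hc, (Real.sq_sqrt hc.le).symm⟩
  rw [Real.sqrt_sq hs.le, div_add_one (by positivity), div_le_div_iff₀ hs (by positivity), one_mul]
  rcases le_total s 1 with h | h
  · nlinarith [mul_nonneg (sq_nonneg s) (mul_nonneg (sub_nonneg.2 h) (add_nonneg zero_le_one hs.le)),
      pow_nonneg hs.le 5]
  · nlinarith [mul_nonneg (pow_nonneg hs.le 4) (sub_nonneg.2 h), sq_nonneg s]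

/-- `η ≤ √η` on `[0, 1]`. -/
theorem le_sqrt_self {η : ℝ} (h0 : 0 ≤ η) (h1 : η ≤ 1) : η ≤ Real.sqrt η :=
  calc η = Real.sqrt (η ^ 2) := (Real.sqrt_sq h0).symm
    _ ≤ Real.sqrt η := Real.sqrt_le_sqrt (by nlinarith)

/-- The mixed error: `2‖Y‖‖H‖ + ‖H‖² ≤ 4 √η D` when `‖Y‖² ≤ 2D`, `‖H‖² ≤ ηD`, `0 ≤ η ≤ 1`. -/
theorem mixed_le {nY nH D η : ℝ} (hY : nY ≤ 2 * D) (hH : nH ≤ η * D) (hη0 : 0 ≤ η) (hη1 : η ≤ 1)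
    (hD : 0 ≤ D) :
    2 * Real.sqrt nY * Real.sqrt nH + nH ≤ 4 * Real.sqrt η * D := by
  have h1 : Real.sqrt nY ≤ Real.sqrt 2 * Real.sqrt D := by
    rw [← Real.sqrt_mul zero_le_two]; exact Real.sqrt_le_sqrt hY
  have h2 : Real.sqrt nH ≤ Real.sqrt η * Real.sqrt D := by
    rw [← Real.sqrt_mul hη0]; exact Real.sqrt_le_sqrt hH
  have h3 : Real.sqrt D * Real.sqrt D = D := Real.mul_self_sqrt hD
  have h4 : Real.sqrt 2 < 3 / 2 := by
    rw [Real.sqrt_lt' (by norm_num)]; norm_num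
  have h5 : η * D ≤ Real.sqrt η * D := mul_le_mul_of_nonneg_right (le_sqrt_self hη0 hη1) hD
  have h6 : 0 ≤ Real.sqrt η * D := by positivity
  calc 2 * Real.sqrt nY * Real.sqrt nH + nH
      ≤ 2 * (Real.sqrt 2 * Real.sqrt D) * (Real.sqrt η * Real.sqrt D) + η * D := by
        gcongr
    _ = 2 * Real.sqrt 2 * Real.sqrt η * (Real.sqrt D * Real.sqrt D) + η * D := by ring
    _ = 2 * Real.sqrt 2 * (Real.sqrt η * D) + η * D := by rw [h3]; ring
    _ ≤ 2 * (3 / 2) * (Real.sqrt η * D) + Real.sqrt η * D := by gcongr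
    _ = 4 * Real.sqrt η * D := by ring

/-- **The real bookkeeping of the assembly.**  With `Q = L − (B_Y + E_r)/2` (one-loop functional),
`L = −Σ_μ T_μ D_μ` (tadpole), `2 D_μ = a_μ + b_μ`, the Hessian margin
`c′ M⁴ K ≤ B_Y/2 + (Σ_μ T_μ a_μ)/2`, `|T_μ| ≤ 80 Λ`, `|E_r| ≤ 32 Λ (2‖Y‖‖H‖ + ‖H‖²)`, `Σ b = ‖H‖² ≤ ηD`,
`‖Y‖² ≤ 2D`, `4S ≤ K + 288 η D`, `D ≤ 2F`, `Λ ≤ (C + 1) M⁴`: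
`Q ≤ 0 − 4c′ M⁴ S + 2 (288 c′ + 104 (C + 1)) √η M⁴ F`. -/
theorem bookkeeping {Q L BY ER K S D F nY nH η M4 Λ c' C : ℝ} {T Dμ a b : Fin 4 → ℝ}
    (hQ : Q = L - (BY + ER) / 2) (hL : L = -∑ μ, T μ * Dμ μ) (hD : ∀ μ, 2 * Dμ μ = a μ + b μ)
    (hMg : c' * M4 * K ≤ BY / 2 + (∑ μ, T μ * a μ) / 2) (hT : ∀ μ, |T μ| ≤ 80 * Λ)
    (hER : |ER| ≤ 32 * Λ * (2 * Real.sqrt nY * Real.sqrt nH + nH)) (hb : ∑ μ, b μ = nH)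
    (hb0 : ∀ μ, 0 ≤ b μ) (hK : 4 * S ≤ K + 288 * η * D) (hnY : nY ≤ 2 * D) (hnH : nH ≤ η * D)
    (hη0 : 0 ≤ η) (hη1 : η ≤ 1) (hD0 : 0 ≤ D) (hDF : D ≤ 2 * F) (hΛ : Λ ≤ (C + 1) * M4)
    (hΛ0 : 0 ≤ Λ) (hC : 0 ≤ C) (hM4 : 1 ≤ M4) (hc' : 0 < c') :
    Q ≤ 0 - 4 * c' * M4 * S + 2 * (288 * c' + 104 * (C + 1)) * Real.sqrt η * M4 * F := by
  -- the tadpole on the Hermitian part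
  have hTH : -(∑ μ, T μ * b μ) ≤ 80 * Λ * nH := by
    rw [← hb, Finset.mul_sum, ← Finset.sum_neg_distrib]
    refine Finset.sum_le_sum fun μ _ => ?_
    rw [← neg_mul]
    exact (mul_le_mul_of_nonneg_right (neg_le_abs _) (hb0 μ)).trans
      (mul_le_mul_of_nonneg_right (hT μ) (hb0 μ))
  have hL' : L = -(∑ μ, T μ * a μ) / 2 - (∑ μ, T μ * b μ) / 2 := by
    rw [hL, neg_div, ← neg_add', Finset.sum_div, Finset.sum_div, ← Finset.sum_add_distrib]
    congr 1
    refine Finset.sum_congr rfl fun μ _ => ?_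
    rw [← add_div, ← mul_add, ← hD μ]
    ring
  have hsD : 0 ≤ Real.sqrt η * D := by positivity
  have h1 : nH ≤ Real.sqrt η * D :=
    hnH.trans (mul_le_mul_of_nonneg_right (le_sqrt_self hη0 hη1) hD0)
  have h2 : 2 * Real.sqrt nY * Real.sqrt nH + nH ≤ 4 * Real.sqrt η * D := mixed_le hnY hnH hη0 hη1 hD0
  have h3 : -ER ≤ 32 * Λ * (4 * Real.sqrt η * D) :=
    ((neg_le_abs _).trans hER).trans (by gcongr)
  have h4 : 80 * Λ * nH ≤ 80 * Λ * (Real.sqrt η * D) := by gcongr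
  have h5 : Λ * (Real.sqrt η * D) ≤ (C + 1) * M4 * (Real.sqrt η * D) :=
    mul_le_mul_of_nonneg_right hΛ hsD
  have h6 : c' * M4 * (4 * S) ≤ c' * M4 * (K + 288 * η * D) :=
    mul_le_mul_of_nonneg_left hK (by positivity)
  have h7 : c' * M4 * (288 * η * D) ≤ c' * M4 * (288 * (Real.sqrt η * D)) := by
    have : η * D ≤ Real.sqrt η * D := mul_le_mul_of_nonneg_right (le_sqrt_self hη0 hη1) hD0
    have hc : 0 ≤ c' * M4 := by positivity
    nlinarith
  have h8 : (288 * c' + 104 * (C + 1)) * M4 * (Real.sqrt η * D) ≤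
      (288 * c' + 104 * (C + 1)) * M4 * (Real.sqrt η * (2 * F)) := by
    have : Real.sqrt η * D ≤ Real.sqrt η * (2 * F) := by gcongr
    have hc : 0 ≤ (288 * c' + 104 * (C + 1)) * M4 := by positivity
    exact mul_le_mul_of_nonneg_left this hc
  nlinarith [hTH, hL', hMg, h3, h4, h5, h6, h7, h8]

end OneLoopMarginOf

/-- **Registered sub-goal of this auxiliary file** (`stub_oneLoopMarginOfAux`, the real bookkeeping
`OneLoopMarginOf.bookkeeping` of the assembly `stub_oneLoopMargin_of`): from the one-loop functional
`Q = L − (B_Y + E_r)/2`, the tadpole `L = −Σ_μ T_μ D_μ` with `2D_μ = a_μ + b_μ`, the Hessian margin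
`c′ M⁴ K ≤ B_Y/2 + (Σ_μ T_μ a_μ)/2`, the bounds `|T_μ| ≤ 80Λ`, `|E_r| ≤ 32Λ(2‖Y‖‖H‖ + ‖H‖²)`,
`Σ b = ‖H‖² ≤ ηD`, `‖Y‖² ≤ 2D`, `4S ≤ K + 288ηD`, `D ≤ 2F`, `Λ ≤ (C + 1)M⁴` (`0 ≤ η ≤ 1`, `M⁴ ≥ 1`):
`Q ≤ 0 − 4c′M⁴S + 2(288c′ + 104(C + 1)) √η M⁴ F`. -/
theorem stub_oneLoopMarginOfAux : ∀ (Q L BY ER K S D F nY nH η M4 Λ c' C : ℝ) (T Dμ a b : Fin 4 → ℝ), Q = L - (BY + ER) / 2 → L = -∑ μ, T μ * Dμ μ → (∀ μ, 2 * Dμ μ = a μ + b μ) → c' * M4 * K ≤ BY / 2 + (∑ μ, T μ * a μ) / 2 → (∀ μ, |T μ| ≤ 80 * Λ) → |ER| ≤ 32 * Λ * (2 * Real.sqrt nY * Real.sqrt nH + nH) → ∑ μ, b μ = nH → (∀ μ, 0 ≤ b μ) → 4 * S ≤ K + 288 * η * D → nY ≤ 2 * D → nH ≤ η * D → 0 ≤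 η → η ≤ 1 → 0 ≤ D → D ≤ 2 * F → Λ ≤ (C + 1) * M4 → 0 ≤ Λ → 0 ≤ C → 1 ≤ M4 → 0 < c' → Q ≤ 0 - 4 * c' * M4 * S + 2 * (288 * c' + 104 * (C + 1)) * Real.sqrt η * M4 * F :=
  fun _ _ _ _ _ _ _ _ _ _ _ _ _ _ _ _ _ _ _ => OneLoopMarginOf.bookkeeping

end Summit.QuantumFields.QCD.Cruxes.CriticalLineDiamagnetism.ChessboardCellGain

end
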